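import Summits.BirchSwinnertonDyer.BirchSwinnertonDyer.Theorems.GenusKolyvaginAtTwoShaCardDvdPowAtTwoRTAntiSymmetrisation
import Summits.BirchSwinnertonDyer.BirchSwinnertonDyer.Theorems.GenusKolyvaginAtTwoShaCardDvdPowAtTwoRTSandwichAssembly
import Summits.BirchSwinnertonDyer.BirchSwinnertonDyer.Theorems.GenusKolyvaginAtTwoOffCutResidualAtTwoRLw2FlatShaFinite
import Summits.BirchSwinnertonDyer.BirchSwinnertonDyer.Theorems.GenusKolyvaginAtTwoOffCutResidualAtTwoRLw2FlatShaFiniteRat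
import Summits.BirchSwinnertonDyer.BirchSwinnertonDyer.Theorems.GenusKolyvaginAtTwoOffCutResidualAtTwoRLw2FlatRestrictionKernel
import HarnessLib

/-!
# Route `GenusKolyvaginAtTwo`, LINE 26 «lw2_phantom_exclusion» of the residual crux `OffCutResidualAtTwoR` (stmt-BirchSwinnertonDyer-31767):
# the FLAT re-thread — part D: **SANDWICH′ (`#Ш(E/K)[2^∞] ∣ 2·#Ш(E/ℚ)[2^∞]`) with its inputs (R′)/(A), from `(NPh at 2N)` instead of an odd multiplicative prime**

Seat `bsd-line-gk2-p5` g40 (WIDTH-5 attach, cell `bsd-f1-sign2`), `--supports stmt-BirchSwinnertonDyer-31767` (helper; closes nothing).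
THEOREMS ONLY (no definition, no named fact, no `sorry`).  **BSD is NOT proved by any of this**; the residual crux is NOT closed by it.
Same surgery as parts A1/A2 (`…Lw2FlatRankDescent`, `…Lw2FlatSharpExponentRat`; see their module docstrings): the binder quadruple
`(v) (h2v) (hNv) (hmult)` of the landed Q3R_T / Q4_T″ cone is replaced by the hypothesis `hNPh : (NPh at 2N)(E, K)` (VERBATIM the conclusion of
`GenusExact.NonPhantomPow.nonPhantomAtTwo_of_hasMultiplicativeReductionAt`), inserted after the two `¬ IsSquare` clauses; proofs are the landed
ones verbatim with `_flat` callees; decl names = originals + `_flat`; namespaces unchanged.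

WHAT (this part).  gk2-p1 g19's SANDWICH′ assembly `…RTSandwichAssembly` (`two_mul_natCard_sha_le_of_inputs`, `natCard_sha_dvd_two_mul_of_inputs`:
`#Ш(E/K)[2^∞] ∣ 2 · #Ш(E/ℚ)[2^∞]` from (R′), (A) and the frame) and its two inputs from `…RTAntiSymmetrisation` ((R′) the `2`-primary relaxed index,
(A) the anti-symmetrisation count).  Imports parts B1/B2 (finiteness currencies, twin Ш-triviality) and C (restriction-kernel frame package).
-/

set_option autoImplicit false
-- the Theorems namespace of this sub repeats the summit name by design (D-0017 nested layout)
set_option linter.dupNamespace false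

noncomputable section

universe u

/-! ## from `GenusKolyvaginAtTwoShaCardDvdPowAtTwoRTAntiSymmetrisation` -/

open scoped Classical

namespace Summit.BirchSwinnertonDyer.BirchSwinnertonDyer.Theorems.GenusExact.PlusDescent

open Literature.NumberTheory.EllipticCurves Literature.NumberTheory.GaloisRepresentations WeierstrassCurve

open NumberField IsDedekindDomain Field Literature.NumberTheory.EllipticCurves.ModularForms AddSubgroup
open Summit.BirchSwinnertonDyer.BirchSwinnertonDyer.Theses.GenusKolyvaginAtTwo (KolyvaginRelationAtTwo)

variable (W : WeierstrassCurve ℚ) [W.IsElliptic] [W.IsGloballyMinimal] [NeZero (W.conductorNorm ℤ)]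
variable (K : Type) [Field K] [NumberField K]

/-- (LINE 26 FLAT form: the hypothesis `(NPh at 2N)(E, K)` replaces the odd multiplicative prime `v`.) **(R′) THE `2`-PRIMARY RELAXED INDEX: `#res⁻¹(Ш(E/K)[2^∞]) ≤ #Ш(E/ℚ)[2^∞] · 2^{ord₂ c(Wd)}`** on U_T's frame (rev-37 binders; only `hndiv`
of the `M₀`-clause used), for ANY elliptic `ℚ`-model `Wd = Cd • E^{(d_K)}` of the twist: `R := res⁻¹(X)` lies in `res⁻¹(Ш(E_K))`, whose index over
`Ш(E/ℚ) ∩ ·` is `≤ 2^{ord₂ c(Wd)}` (gk2-p3's `Ш`-level genus budget); and `Ш(E/ℚ) ∩ R ⊂ Ш(E/ℚ)[2^∞]` (`2^k res b = 0 ⟹ 2^{k+1} b = 0`), a finite group.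
[cite: Kramer1981, Thm. 1 and §2 Prop. 3] [cite: GrossLMS1991, §5 (5.3)] -/
theorem natCard_comap_resBaseChange_shaPrimary_le_onHabitat_flat (hQ2 : KolyvaginRelationAtTwo) (hcm : ¬ W.HasCM)
    (hT : Odd W.tamagawaProduct) (hneg : W.Δ < 0)
    (hIQ : IsImaginaryQuadratic K) (hodd : Odd (NumberField.discr K))
    (h3 : NumberField.discr K ≠ -3) (hHe : SatisfiesHeegnerHypothesis (W.conductorNorm ℤ) K)
    (hsq1 : ¬ IsSquare ((NumberField.discr K : ℚ) * -|W.Δ|)) (hsq2 : ¬ IsSquare ((NumberField.discr K : ℚ) * (-(2 * |W.Δ|))))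
    (hNPh : ∀ (Mlev : ℕ), 1 ≤ Mlev → ∀ z : galH1Torsion (W.baseChange K) ((2 ^ Mlev : ℕ) : ℤ),
      (∀ ρ ∈ torsionFixing (W.baseChange K) ((2 ^ Mlev : ℕ) : ℤ), h1Eval (W.baseChange K) ((2 ^ Mlev : ℕ) : ℤ) z ρ = 0) →
      (∀ w : HeightOneSpectrum (𝓞 K), ((2 * W.conductorNorm ℤ : ℕ) : 𝓞 K) ∈ w.asIdeal →
        z ∈ selmerLocalKer (W.baseChange K) (w.adicCompletion K) ((2 ^ Mlev : ℕ) : ℤ)) → z = 0)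
    (hρ : ∀ n : ℕ, 0 < n → W.HasSurjectiveModNGaloisRep ((2 : ℤ) ^ n))
    (Dt : ModularParametrizationData W (W.conductorNorm ℤ)) (β : ℤ) (ι : K →+* ℂ) (d₁ : KolyvaginHeegnerData Dt β ι 1) (M₀ : ℕ)
    (hndiv : ¬ ∃ Q : (W.baseChange (ringClassField K ι 1)).toAffine.Point, ((2 ^ (M₀ + 1) : ℕ) : ℤ) • Q = d₁.derivedPoint)
    {Wd : WeierstrassCurve ℚ} [Wd.IsElliptic] (Cd : VariableChange ℚ) (hWd : Cd • W.quadraticTwist (NumberField.discr K : ℚ) = Wd) :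
    Nat.card (((AddCommGroup.primaryComponent (↥(W.baseChange K).sha) 2).map (W.baseChange K).sha.subtype).comap
        (resBaseChange W K)) ≤
      Nat.card (AddCommGroup.primaryComponent (↥W.sha) 2) * 2 ^ padicValNat 2 Wd.tamagawaProduct := by
  haveI : Fact (Nat.Prime 2) := ⟨Nat.prime_two⟩
  have h2 : Module.finrank ℚ K = 2 := hIQ.1
  obtain ⟨σ₀, -, hσ₀, -⟩ := exists_gal_ne_one_sqrt_discr K h2
  set R := ((AddCommGroup.primaryComponent (↥(W.baseChange K).sha) 2).map (W.baseChange K).sha.subtype).comap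
    (resBaseChange W K) with hR
  set Rf := ((W.baseChange K).sha).comap (resBaseChange W K) with hRf
  have hle : R ≤ Rf := AddSubgroup.comap_mono (AddSubgroup.map_subtype_le _)
  obtain ⟨hne, hbudget⟩ :=
    relIndex_sha_comap_resBaseChange_le_two_pow_padicValNat_tamagawaProduct_twin_of_Δ_neg W K hneg hIQ hodd hHe hT Cd hWd
  have hidx : (W.sha).relIndex R ≤ 2 ^ padicValNat 2 Wd.tamagawaProduct :=
    (AddSubgroup.relIndex_le_of_le_right hle hne).trans hbudget
  -- `Ш(E/ℚ) ∩ R ↪ Ш(E/ℚ)[2^∞]`, finite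
  haveI hYfin : Finite (AddCommGroup.primaryComponent (↥W.sha) 2) :=
    finite_primaryComponent_sha_rat_two_onHabitat_flat hQ2 W hcm hT hneg K hIQ hodd h3 hHe hsq1 hsq2 hNPh hρ Dt β ι d₁ M₀ hndiv
  have hinter : Nat.card ((W.sha).addSubgroupOf R) ≤ Nat.card (AddCommGroup.primaryComponent (↥W.sha) 2) := by
    refine Nat.card_le_card_of_injective
      (fun b ↦ (⟨⟨((b : R) : W.galH1), AddSubgroup.mem_addSubgroupOf.mp b.2⟩, ?_⟩ : AddCommGroup.primaryComponent (↥W.sha) 2)) ?_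
    · obtain ⟨-, k, hk⟩ := (SelmerDescent.mem_comap_resBaseChange_shaPrimary_iff W ((b : R) : W.galH1)).mp (b : R).2
      have h2k : 2 ^ (k + 1) • ((b : R) : W.galH1) = 0 := by
        have hres0 : resBaseChange W K (2 ^ k • ((b : R) : W.galH1)) = 0 := by rw [map_nsmul, hk]
        have h := SelmerDescent.two_nsmul_eq_zero_of_resBaseChange_eq_zero W h2 hσ₀ hres0
        rwa [smul_smul, ← pow_succ'] at h
      exact (AddCommGroup.mem_primaryComponent).mpr
        ⟨k + 1, Subtype.ext (by rw [AddSubgroupClass.coe_nsmul, ZeroMemClass.coe_zero]; exact h2k)⟩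
    · intro b₁ b₂ h
      apply Subtype.ext
      apply Subtype.ext
      exact congrArg (fun z : AddCommGroup.primaryComponent (↥W.sha) 2 ↦ ((z : ↥W.sha) : W.galH1)) h
  -- `#R = [R : Ш ∩ R] · #(Ш ∩ R)`
  have hsplit : Nat.card ((W.sha).addSubgroupOf R) * (W.sha).relIndex R = Nat.card R := AddSubgroup.card_mul_index _
  calc Nat.card R = Nat.card ((W.sha).addSubgroupOf R) * (W.sha).relIndex R := hsplit.symm
    _ ≤ Nat.card (AddCommGroup.primaryComponent (↥W.sha) 2) * 2 ^ padicValNat 2 Wd.tamagawaProduct :=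
        Nat.mul_le_mul hinter hidx

/-- (LINE 26 FLAT form: the hypothesis `(NPh at 2N)(E, K)` replaces the odd multiplicative prime `v`.) **(A) THE ANTI-SYMMETRISATION BOUND: `#(1 − τ_*) Ш(E/K)[2^∞] ≤ 2^{ord₂ c(Wd)}`** on U_T's frame with `W.rootNumber = 1`, `σ ≠ 1` in
`Aut(K/ℚ)` (chosen lift `liftAut σ`), for ANY elliptic `ℚ`-model `Wd = Cd • E^{(d_K)}` of the twist with `#Sel₂(Wd) = 2`: see the module
docstring (`(1 − τ_*)(ψ_* s) = ψ_*(res'(cor' s))` by the sign rule; `C = cor'(ψ_*⁻¹ X)` has `C ∩ Ш(T/ℚ) = 0` and index `≤ 2^{ord₂ c(T)} =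
2^{ord₂ c(Wd)}` in the twin's relaxed group).  [cite: Kramer1981, Thm. 1 and §2 Prop. 3] [cite: GrossLMS1991, §5 (5.1)–(5.3)]
[cite: SerreGaloisCohomology1997, I §2.4 Prop. 9] -/
theorem natCard_map_sub_conjH1Points_shaPrimary_le_onHabitat_flat (hQ2 : KolyvaginRelationAtTwo) (hcm : ¬ W.HasCM)
    (hT : Odd W.tamagawaProduct) (hneg : W.Δ < 0)
    (hIQ : IsImaginaryQuadratic K) (hodd : Odd (NumberField.discr K))
    (h3 : NumberField.discr K ≠ -3) (hHe : SatisfiesHeegnerHypothesis (W.conductorNorm ℤ) K)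
    (hsq1 : ¬ IsSquare ((NumberField.discr K : ℚ) * -|W.Δ|)) (hsq2 : ¬ IsSquare ((NumberField.discr K : ℚ) * (-(2 * |W.Δ|))))
    (hNPh : ∀ (Mlev : ℕ), 1 ≤ Mlev → ∀ z : galH1Torsion (W.baseChange K) ((2 ^ Mlev : ℕ) : ℤ),
      (∀ ρ ∈ torsionFixing (W.baseChange K) ((2 ^ Mlev : ℕ) : ℤ), h1Eval (W.baseChange K) ((2 ^ Mlev : ℕ) : ℤ) z ρ = 0) →
      (∀ w : HeightOneSpectrum (𝓞 K), ((2 * W.conductorNorm ℤ : ℕ) : 𝓞 K) ∈ w.asIdeal →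
        z ∈ selmerLocalKer (W.baseChange K) (w.adicCompletion K) ((2 ^ Mlev : ℕ) : ℤ)) → z = 0)
    (hρ : ∀ n : ℕ, 0 < n → W.HasSurjectiveModNGaloisRep ((2 : ℤ) ^ n))
    (Dt : ModularParametrizationData W (W.conductorNorm ℤ)) (β : ℤ) (ι : K →+* ℂ) (d₁ : KolyvaginHeegnerData Dt β ι 1)
    (hy : ¬ IsOfFinAddOrder d₁.derivedPoint) (M₀ : ℕ)
    (hndiv : ¬ ∃ Q : (W.baseChange (ringClassField K ι 1)).toAffine.Point, ((2 ^ (M₀ + 1) : ℕ) : ℤ) • Q = d₁.derivedPoint)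
    (hw : W.rootNumber = 1) {σ : K ≃ₐ[ℚ] K} (hσ1 : σ ≠ 1)
    {Wd : WeierstrassCurve ℚ} [Wd.IsElliptic] (Cd : VariableChange ℚ) (hWd : Cd • W.quadraticTwist (NumberField.discr K : ℚ) = Wd)
    (hSel : Nat.card (Wd.selmerGroup 2) = 2) :
    Nat.card (((AddCommGroup.primaryComponent (↥(W.baseChange K).sha) 2).map (W.baseChange K).sha.subtype).map
        (AddMonoidHom.id (W.baseChange K).galH1 - (isLiftOfAut_liftAut σ).conjH1Points W)) ≤
      2 ^ padicValNat 2 Wd.tamagawaProduct := by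
  haveI : Fact (Nat.Prime 2) := ⟨Nat.prime_two⟩
  have h2 : Module.finrank ℚ K = 2 := hIQ.1
  have hdK : (NumberField.discr K : ℚ) ≠ 0 := by exact_mod_cast NumberField.discr_ne_zero K
  obtain ⟨τ, θ₀, hτ1, hθ₀Q, hθ₀, hτθ₀, hall⟩ := exists_gal_ne_one_sqrt_discr K h2
  obtain rfl : σ = τ := (hall σ).resolve_left hσ1
  obtain ⟨C, hC⟩ := W.exists_variableChange_quadraticTwist_one
  haveI hTell : (W.quadraticTwist (NumberField.discr K : ℚ)).IsElliptic := W.isElliptic_quadraticTwist hdK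
  have hK : ∀ w : InfinitePlace K, w.IsComplex := hIQ.2.isComplex
  -- ### the objects
  set X : AddSubgroup ↥(W.baseChange K).sha := AddCommGroup.primaryComponent (↥(W.baseChange K).sha) 2 with hX
  set Xs : AddSubgroup (W.baseChange K).galH1 := X.map (W.baseChange K).sha.subtype with hXs
  set δ : (W.baseChange K).galH1 →+ (W.baseChange K).galH1 :=
    AddMonoidHom.id (W.baseChange K).galH1 - (isLiftOfAut_liftAut σ).conjH1Points W with hδ
  set Φ := h1Equiv (twistIso W hθ₀Q hθ₀ hC) (twistIso_smul W hθ₀Q hθ₀ hC) with hΦ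
  set cor' := corBaseChange K (W.quadraticTwist (NumberField.discr K : ℚ)) σ h2 hσ1 with hcor'
  set res' := resBaseChange (W.quadraticTwist (NumberField.discr K : ℚ)) K with hres'
  -- ### the key identity `(1 − τ_*)(ψ_* s) = ψ_*(res'(cor' s))`
  have hkey : ∀ s, δ (Φ s) = Φ (res' (cor' s)) := by
    intro s
    rw [hres', hcor', resBaseChange_corBaseChange K (W.quadraticTwist (NumberField.discr K : ℚ)) σ h2 hσ1 (isLiftOfAut_liftAut σ) s,
      map_add, hΦ, h1Equiv_twistIso_conjH1Points W hθ₀Q hθ₀ hC (isLiftOfAut_liftAut σ) hτθ₀ s, hδ, AddMonoidHom.sub_apply,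
      AddMonoidHom.id_apply, sub_eq_add_neg]
  -- ### `C := cor'(ψ_*⁻¹ Xs)`
  set π : (W.baseChange K).galH1 →+ (W.quadraticTwist (NumberField.discr K : ℚ)).galH1 :=
    cor'.comp Φ.symm.toAddMonoidHom with hπ
  have hπapp : ∀ x, Φ (res' (π x)) = δ x := fun x ↦ by
    rw [hπ, AddMonoidHom.comp_apply, AddEquiv.coe_toAddMonoidHom, ← hkey, AddEquiv.apply_symm_apply]
  set Cg := Xs.map π with hCg
  -- ### finiteness
  haveI hXfin : Finite X :=
    finite_primaryComponent_sha_two_onHabitat_flat hQ2 W hcm hT hneg K hIQ hodd h3 hHe hsq1 hsq2 hNPh hρ Dt β ι d₁ M₀ hndiv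
  haveI hXsfin : Finite Xs := by
    have h : (Xs : Set (W.baseChange K).galH1).Finite := by
      rw [hXs, AddSubgroup.coe_map]; exact (Set.toFinite _).image _
    exact h.to_subtype
  haveI hCfin : Finite Cg := by
    have h : (Cg : Set (W.quadraticTwist (NumberField.discr K : ℚ)).galH1).Finite := by
      rw [hCg, AddSubgroup.coe_map]; exact (Set.toFinite _).image _
    exact h.to_subtype
  -- ### `(1 − τ_*)Xs` is the image of `C` under `ψ_* ∘ res'`
  have hsurj : Nat.card (Xs.map δ) ≤ Nat.card Cg := by
    refine Nat.card_le_card_of_surjective (fun c : Cg ↦ (⟨Φ (res' (c : (W.quadraticTwist _).galH1)), ?_⟩ : Xs.map δ)) ?_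
    · obtain ⟨x, hx, hxc⟩ := AddSubgroup.mem_map.mp c.2
      rw [← hxc, hπapp]
      exact AddSubgroup.mem_map.mpr ⟨x, hx, rfl⟩
    · rintro ⟨y, hy'⟩
      obtain ⟨x, hx, rfl⟩ := AddSubgroup.mem_map.mp hy'
      exact ⟨⟨π x, AddSubgroup.mem_map.mpr ⟨x, hx, rfl⟩⟩, Subtype.ext (hπapp x)⟩
  -- ### `C ⊂ res'⁻¹(Ш(T_K))`
  have hCle : Cg ≤ ((W.quadraticTwist (NumberField.discr K : ℚ)).baseChange K).sha.comap res' := by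
    rintro _ ⟨x, hx, rfl⟩
    have hxsha : x ∈ (W.baseChange K).sha := by
      obtain ⟨x', -, rfl⟩ := AddSubgroup.mem_map.mp hx
      exact x'.2
    have hs : Φ.symm x ∈ ((W.quadraticTwist (NumberField.discr K : ℚ)).baseChange K).sha := by
      rw [mem_sha_iff_h1Equiv_twistIso_mem W hθ₀Q hθ₀ hC, ← hΦ, AddEquiv.apply_symm_apply]
      exact hxsha
    rw [AddSubgroup.mem_comap, hπ, AddMonoidHom.comp_apply, AddEquiv.coe_toAddMonoidHom, hres', hcor',
      resBaseChange_corBaseChange K _ σ h2 hσ1 (isLiftOfAut_liftAut σ)]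
    exact AddSubgroup.add_mem _ hs (SylvesterTwoShaConjugation.conjH1Points_mem_sha _ hK (isLiftOfAut_liftAut σ) hs)
  -- ### `Ш(T/ℚ)[2^∞] = 0` (the minimal twin) ⟹ `Ш(T/ℚ) ∩ C = 0`
  have hSelT : Nat.card ((W.quadraticTwist (NumberField.discr K : ℚ)).selmerGroup 2) = 2 := by
    rw [natCard_selmerGroup_eq_of_variableChange 2 hWd]; exact hSel
  have hShaT := forall_primaryComponent_sha_twin_two_eq_zero_onHabitat_flat hQ2 W hcm hT hneg K hIQ hodd h3 hHe hsq1 hsq2 hNPh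
    hρ Dt β ι d₁ hy M₀ hndiv hw (W.quadraticTwist (NumberField.discr K : ℚ)) ⟨1, one_smul _ _⟩ hSelT
  have hbot : ((W.quadraticTwist (NumberField.discr K : ℚ)).sha).addSubgroupOf Cg = ⊥ := by
    rw [eq_bot_iff]
    intro c hc
    rw [AddSubgroup.mem_addSubgroupOf] at hc
    rw [AddSubgroup.mem_bot]
    obtain ⟨x, hx, hxc⟩ := AddSubgroup.mem_map.mp c.2
    obtain ⟨x', hx', rfl⟩ := AddSubgroup.mem_map.mp hx
    obtain ⟨k, hk⟩ := (AddCommGroup.mem_primaryComponent).mp hx'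
    have h0 : 2 ^ k • ((c : Cg) : (W.quadraticTwist (NumberField.discr K : ℚ)).galH1) = 0 := by
      rw [← hxc, ← map_nsmul, AddSubgroup.coe_subtype, ← AddSubgroupClass.coe_nsmul, hk, ZeroMemClass.coe_zero, map_zero]
    have hmem : (⟨_, hc⟩ : ↥(W.quadraticTwist (NumberField.discr K : ℚ)).sha) ∈
        AddCommGroup.primaryComponent (↥(W.quadraticTwist (NumberField.discr K : ℚ)).sha) 2 :=
      (AddCommGroup.mem_primaryComponent).mpr ⟨k, Subtype.ext (by rw [AddSubgroupClass.coe_nsmul, ZeroMemClass.coe_zero]; exact h0)⟩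
    exact Subtype.ext (by simpa using congrArg Subtype.val (hShaT _ hmem))
  -- ### count in the twin's relaxed group
  obtain ⟨hne, hle⟩ := relIndex_sha_comap_resBaseChange_twin_le_two_pow W (K := K) hneg hIQ hodd hHe hT
    (Wd := W.quadraticTwist (NumberField.discr K : ℚ)) 1 (one_smul _ _)
  have hidx : ((W.quadraticTwist (NumberField.discr K : ℚ)).sha).relIndex Cg = Nat.card Cg := by
    change (((W.quadraticTwist (NumberField.discr K : ℚ)).sha).addSubgroupOf Cg).index = _
    rw [hbot, AddSubgroup.index_bot]
  have hCcard : Nat.card Cg ≤ 2 ^ padicValNat 2 (W.quadraticTwist (NumberField.discr K : ℚ)).tamagawaProduct := by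
    rw [← hidx]; exact (AddSubgroup.relIndex_le_of_le_right hCle hne).trans hle
  -- ### `ord₂ c(T) = ord₂ c(Wd)` (both equal the genus budget `Σ_{q ∣ d_K} i_q`)
  have heq : padicValNat 2 (W.quadraticTwist (NumberField.discr K : ℚ)).tamagawaProduct = padicValNat 2 Wd.tamagawaProduct := by
    have h1 := prod_ncard_roots_add_one_eq_two_pow_padicValNat_tamagawaProduct_twin W hIQ hodd hHe hT
      (Wd := W.quadraticTwist (NumberField.discr K : ℚ)) 1 (one_smul _ _)
    have h2' := prod_ncard_roots_add_one_eq_two_pow_padicValNat_tamagawaProduct_twin W hIQ hodd hHe hT Cd hWd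
    exact Nat.pow_right_injective le_rfl (h1.symm.trans h2')
  calc Nat.card (Xs.map δ) ≤ Nat.card Cg := hsurj
    _ ≤ 2 ^ padicValNat 2 (W.quadraticTwist (NumberField.discr K : ℚ)).tamagawaProduct := hCcard
    _ = 2 ^ padicValNat 2 Wd.tamagawaProduct := by rw [heq]

end Summit.BirchSwinnertonDyer.BirchSwinnertonDyer.Theorems.GenusExact.PlusDescent

/-! ## from `GenusKolyvaginAtTwoShaCardDvdPowAtTwoRTSandwichAssembly` -/

open scoped Classical

namespace Summit.BirchSwinnertonDyer.BirchSwinnertonDyer.Theorems.GenusExact.PlusDescent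

open Literature.NumberTheory.EllipticCurves Literature.NumberTheory.GaloisRepresentations WeierstrassCurve NumberField
  IsDedekindDomain Field Literature.NumberTheory.EllipticCurves.ModularForms AddSubgroup
open Summit.BirchSwinnertonDyer.BirchSwinnertonDyer.Theses.GenusKolyvaginAtTwo (KolyvaginRelationAtTwo)

variable (W : WeierstrassCurve ℚ) [W.IsElliptic] [W.IsGloballyMinimal] [NeZero (W.conductorNorm ℤ)]
variable (K : Type) [Field K] [NumberField K]

/-- (LINE 26 FLAT form: the hypothesis `(NPh at 2N)(E, K)` replaces the odd multiplicative prime `v`.) **SANDWICH′ ASSEMBLY.**  On U_T's frame (rev-37 binders; only `hndiv` of the `M₀`-clause used) with `W.rootNumber = 1`, for the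
non-trivial `σ ∈ Aut(K/ℚ)` with chosen lift `τ`: writing `X = Ш(E/K)[2^∞] ≤ H¹(K, E_K)` (as a subgroup of `galH1`), if
`#res⁻¹(X) ≤ A` (the relaxed-index input) and `#(1 − τ_*)(X) ≤ B` (the anti-symmetrisation input), then **`2 · #Ш(E/K)[2^∞] ≤ A · B`**.
[cite: Kramer1981, Thm. 1 and proof of Thm. 2] [cite: GrossLMS1991, §5 (5.1)–(5.3)] [cite: SerreGaloisCohomology1997, I §5.8] -/
theorem two_mul_natCard_sha_le_of_inputs_flat (hQ2 : KolyvaginRelationAtTwo) (hcm : ¬ W.HasCM)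
    (hT : Odd W.tamagawaProduct) (hneg : W.Δ < 0)
    (hIQ : IsImaginaryQuadratic K) (hodd : Odd (NumberField.discr K))
    (h3 : NumberField.discr K ≠ -3) (hHe : SatisfiesHeegnerHypothesis (W.conductorNorm ℤ) K)
    (hsq1 : ¬ IsSquare ((NumberField.discr K : ℚ) * -|W.Δ|)) (hsq2 : ¬ IsSquare ((NumberField.discr K : ℚ) * (-(2 * |W.Δ|))))
    (hNPh : ∀ (Mlev : ℕ), 1 ≤ Mlev → ∀ z : galH1Torsion (W.baseChange K) ((2 ^ Mlev : ℕ) : ℤ),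
      (∀ ρ ∈ torsionFixing (W.baseChange K) ((2 ^ Mlev : ℕ) : ℤ), h1Eval (W.baseChange K) ((2 ^ Mlev : ℕ) : ℤ) z ρ = 0) →
      (∀ w : HeightOneSpectrum (𝓞 K), ((2 * W.conductorNorm ℤ : ℕ) : 𝓞 K) ∈ w.asIdeal →
        z ∈ selmerLocalKer (W.baseChange K) (w.adicCompletion K) ((2 ^ Mlev : ℕ) : ℤ)) → z = 0)
    (hρ : ∀ n : ℕ, 0 < n → W.HasSurjectiveModNGaloisRep ((2 : ℤ) ^ n))
    (Dt : ModularParametrizationData W (W.conductorNorm ℤ)) (β : ℤ) (ι : K →+* ℂ) (d₁ : KolyvaginHeegnerData Dt β ι 1) (M₀ : ℕ)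
    (hndiv : ¬ ∃ Q : (W.baseChange (ringClassField K ι 1)).toAffine.Point, ((2 ^ (M₀ + 1) : ℕ) : ℤ) • Q = d₁.derivedPoint)
    (hw : W.rootNumber = 1) {σ : K ≃ₐ[ℚ] K} (hσ1 : σ ≠ 1) (A B : ℕ)
    (hR : Nat.card (((AddCommGroup.primaryComponent (↥(W.baseChange K).sha) 2).map (W.baseChange K).sha.subtype).comap
      (resBaseChange W K)) ≤ A)
    (hA : Nat.card (((AddCommGroup.primaryComponent (↥(W.baseChange K).sha) 2).map (W.baseChange K).sha.subtype).map
      (AddMonoidHom.id (W.baseChange K).galH1 - (isLiftOfAut_liftAut σ).conjH1Points W)) ≤ B) :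
    2 * Nat.card (AddCommGroup.primaryComponent (↥(W.baseChange K).sha) 2) ≤ A * B := by
  haveI : Fact (Nat.Prime 2) := ⟨Nat.prime_two⟩
  -- ### the objects
  set X : AddSubgroup ↥(W.baseChange K).sha := AddCommGroup.primaryComponent (↥(W.baseChange K).sha) 2 with hX
  set Xs : AddSubgroup (W.baseChange K).galH1 := X.map (W.baseChange K).sha.subtype with hXs
  set res := resBaseChange W K with hres
  set τs := (isLiftOfAut_liftAut σ).conjH1Points W with hτs
  set δ : (W.baseChange K).galH1 →+ (W.baseChange K).galH1 := AddMonoidHom.id _ - τs with hδ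
  set R : AddSubgroup W.galH1 := Xs.comap res with hRdef
  -- ### finiteness of `X`, `Xs`
  haveI hXfin : Finite X :=
    finite_primaryComponent_sha_two_onHabitat_flat hQ2 W hcm hT hneg K hIQ hodd h3 hHe hsq1 hsq2 hNPh hρ Dt β ι d₁ M₀ hndiv
  haveI hXsfin : Finite Xs := by
    have h : (Xs : Set (W.baseChange K).galH1).Finite := by
      rw [hXs, AddSubgroup.coe_map]
      exact (Set.toFinite _).image _
    exact h.to_subtype
  have hcardXs : Nat.card Xs = Nat.card X :=
    (Nat.card_congr (X.equivMapOfInjective (W.baseChange K).sha.subtype (W.baseChange K).sha.subtype_injective).toEquiv).symm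
  -- ### `#Xs = #ker(δ|_Xs) · #δ(Xs)`
  have hsplit := natCard_eq_natCard_ker_mul_natCard_map Xs δ
  -- ### `R` is finite: `ker(res|_R)` is finite (the local kernel at `K`) and `res(R) ⊆ Xs`
  have hmaple : R.map res ≤ Xs := AddSubgroup.map_comap_le _ _
  haveI hRmapfin : Finite (R.map res) := Finite.of_injective (AddSubgroup.inclusion hmaple) (AddSubgroup.inclusion_injective hmaple)
  have hkerfin : (res.ker : Set W.galH1).Finite := by
    have h := finite_localRestrictionKer_numberField W K
    refine h.subset fun c hc ↦ ?_
    exact (mem_ker_resBaseChange_iff W K c).mp ((AddMonoidHom.mem_ker).mp hc)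
  haveI : Finite res.ker := hkerfin.to_subtype
  set ρ : R →+ (W.baseChange K).galH1 := res.comp R.subtype with hρdef
  haveI hρkerfin : Finite ρ.ker := by
    refine Finite.of_injective (fun k : ρ.ker ↦ (⟨((k : R) : W.galH1), ?_⟩ : res.ker)) ?_
    · exact (AddMonoidHom.mem_ker).mpr ((AddMonoidHom.mem_ker).mp k.2)
    · intro k₁ k₂ h
      apply Subtype.ext
      apply Subtype.ext
      exact congrArg (fun z : res.ker ↦ (z : W.galH1)) h
  have hρrange : ρ.range = R.map res := by rw [hρdef, AddMonoidHom.range_comp, AddSubgroup.range_subtype]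
  haveI hρrangefin : Finite ρ.range := by rw [hρrange]; exact hRmapfin
  haveI hRfin : Finite R := (AddMonoidHom.finite_iff_finite_ker_range ρ).mpr ⟨hρkerfin, hρrangefin⟩
  -- ### `#R = #ker(ρ) · #res(R)` with `#ker(ρ) ≥ 2` (the Kramer class)
  have hRsplit : Nat.card R = Nat.card ρ.ker * Nat.card (R.map res) := natCard_eq_natCard_ker_mul_natCard_map R res
  obtain ⟨η, hη0, hηres⟩ := exists_ne_zero_resBaseChange_eq_zero_onHabitat_flat W K hQ2 hcm hT hneg hIQ hodd h3 hHe hsq1 hsq2 hNPh hρ Dt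
    β ι d₁ M₀ hndiv hw
  have hηR : η ∈ R := by
    rw [hRdef, AddSubgroup.mem_comap]
    have h0 : res η = 0 := hηres
    rw [h0]
    exact Xs.zero_mem
  have hker2 : 2 ≤ Nat.card ρ.ker := by
    have hnt : Nontrivial ρ.ker := by
      refine ⟨⟨⟨⟨η, hηR⟩, (AddMonoidHom.mem_ker).mpr ?_⟩, 0, fun h ↦ hη0 ?_⟩⟩
      · change res ((⟨η, hηR⟩ : R) : W.galH1) = 0
        exact hηres
      · exact congrArg (fun z : ρ.ker ↦ ((z : R) : W.galH1)) h
    exact Finite.one_lt_card_iff_nontrivial.mpr hnt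
  have hmapR : 2 * Nat.card (R.map res) ≤ A := by
    calc 2 * Nat.card (R.map res) ≤ Nat.card ρ.ker * Nat.card (R.map res) := Nat.mul_le_mul_right _ hker2
      _ = Nat.card R := hRsplit.symm
      _ ≤ A := hR
  -- ### `ker(δ|_Xs) ↪ res(R)`: invariant classes are restrictions
  have hkerle : Nat.card (δ.comp Xs.subtype).ker ≤ Nat.card (R.map res) := by
    refine Nat.card_le_card_of_injective (fun k ↦ (⟨((k : Xs) : (W.baseChange K).galH1), ?_⟩ : R.map res)) ?_
    · -- `δ k = 0` ⟹ `τ_* k = k` ⟹ `k = res b`, and `b ∈ R`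
      have hk : τs ((k : Xs) : (W.baseChange K).galH1) = ((k : Xs) : (W.baseChange K).galH1) := by
        have h := (AddMonoidHom.mem_ker).mp k.2
        change ((k : Xs) : (W.baseChange K).galH1) - τs ((k : Xs) : (W.baseChange K).galH1) = 0 at h
        exact (sub_eq_zero.mp h).symm
      obtain ⟨b, hb⟩ := exists_resBaseChange_eq_of_conjH1Points_eq_onHabitat_flat W K hQ2 hcm hT hneg hIQ hodd h3 hHe hsq1 hsq2 hNPh
        hρ Dt β ι d₁ M₀ hndiv hw hσ1 hk
      refine AddSubgroup.mem_map.mpr ⟨b, ?_, hb⟩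
      rw [hRdef, AddSubgroup.mem_comap]
      have hb' : res b = ((k : Xs) : (W.baseChange K).galH1) := hb
      rw [hb']
      exact (k : Xs).2
    · intro k₁ k₂ h
      apply Subtype.ext
      apply Subtype.ext
      exact congrArg (fun z : R.map res ↦ (z : (W.baseChange K).galH1)) h
  -- ### `#δ(Xs) ≤ B`
  have hrange : Nat.card (Xs.map δ) ≤ B := hA
  -- ### combine
  calc 2 * Nat.card X = 2 * (Nat.card (δ.comp Xs.subtype).ker * Nat.card (Xs.map δ)) := by rw [← hsplit, hcardXs]
    _ ≤ 2 * (Nat.card (R.map res) * B) := Nat.mul_le_mul_left 2 (Nat.mul_le_mul hkerle hrange)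
    _ = (2 * Nat.card (R.map res)) * B := by ring
    _ ≤ A * B := Nat.mul_le_mul_right B hmapR

/-- (LINE 26 FLAT form: the hypothesis `(NPh at 2N)(E, K)` replaces the odd multiplicative prime `v`.) **SANDWICH′ FROM ITS TWO INPUTS (the numerical closer).**  On U_T's frame with `W.rootNumber = 1`, `σ ≠ 1` and an exponent `e ≤ 1`
(the memo's `DEF = ord₂ c(Wd)` of the minimal twin): if `#res⁻¹(X) ≤ #Ш(E/ℚ)[2^∞] · 2^e` (relaxed index, input (R)) and
`#(1 − τ_*)X ≤ 2^e` (anti-symmetrisation, input (A)), then **`#Ш(E/K)[2^∞] ∣ 2 · #Ш(E/ℚ)[2^∞]`** — literally the conclusion of the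
registered stub `stub_sandwichOfMinimalTwin_flat` (LINE 19).  (`#X = 4^t` by gk2-p5 g29's
`exists_natCard_primaryComponent_sha_two_eq_pow_two_mul_onHabitat_flat`; `#Ш(E/ℚ)[2^∞]` is `0` (excluded by the inequality) or a power of `2`.)
[cite: Kramer1981, Thm. 1 and proof of Thm. 2] [cite: GrossLMS1991, §5 (5.1)–(5.3)] -/
theorem natCard_sha_dvd_two_mul_of_inputs_flat (hQ2 : KolyvaginRelationAtTwo) (hcm : ¬ W.HasCM)
    (hT : Odd W.tamagawaProduct) (hneg : W.Δ < 0)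
    (hIQ : IsImaginaryQuadratic K) (hodd : Odd (NumberField.discr K))
    (h3 : NumberField.discr K ≠ -3) (hHe : SatisfiesHeegnerHypothesis (W.conductorNorm ℤ) K)
    (hsq1 : ¬ IsSquare ((NumberField.discr K : ℚ) * -|W.Δ|)) (hsq2 : ¬ IsSquare ((NumberField.discr K : ℚ) * (-(2 * |W.Δ|))))
    (hNPh : ∀ (Mlev : ℕ), 1 ≤ Mlev → ∀ z : galH1Torsion (W.baseChange K) ((2 ^ Mlev : ℕ) : ℤ),
      (∀ ρ ∈ torsionFixing (W.baseChange K) ((2 ^ Mlev : ℕ) : ℤ), h1Eval (W.baseChange K) ((2 ^ Mlev : ℕ) : ℤ) z ρ = 0) →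
      (∀ w : HeightOneSpectrum (𝓞 K), ((2 * W.conductorNorm ℤ : ℕ) : 𝓞 K) ∈ w.asIdeal →
        z ∈ selmerLocalKer (W.baseChange K) (w.adicCompletion K) ((2 ^ Mlev : ℕ) : ℤ)) → z = 0)
    (hρ : ∀ n : ℕ, 0 < n → W.HasSurjectiveModNGaloisRep ((2 : ℤ) ^ n))
    (Dt : ModularParametrizationData W (W.conductorNorm ℤ)) (β : ℤ) (ι : K →+* ℂ) (d₁ : KolyvaginHeegnerData Dt β ι 1) (M₀ : ℕ)
    (hndiv : ¬ ∃ Q : (W.baseChange (ringClassField K ι 1)).toAffine.Point, ((2 ^ (M₀ + 1) : ℕ) : ℤ) • Q = d₁.derivedPoint)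
    (hw : W.rootNumber = 1) {σ : K ≃ₐ[ℚ] K} (hσ1 : σ ≠ 1) (e : ℕ) (he : e ≤ 1)
    (hR : Nat.card (((AddCommGroup.primaryComponent (↥(W.baseChange K).sha) 2).map (W.baseChange K).sha.subtype).comap
      (resBaseChange W K)) ≤ Nat.card (AddCommGroup.primaryComponent (↥W.sha) 2) * 2 ^ e)
    (hA : Nat.card (((AddCommGroup.primaryComponent (↥(W.baseChange K).sha) 2).map (W.baseChange K).sha.subtype).map
      (AddMonoidHom.id (W.baseChange K).galH1 - (isLiftOfAut_liftAut σ).conjH1Points W)) ≤ 2 ^ e) :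
    Nat.card (AddCommGroup.primaryComponent (↥(W.baseChange K).sha) 2) ∣
      2 * Nat.card (AddCommGroup.primaryComponent (↥W.sha) 2) := by
  haveI : Fact (Nat.Prime 2) := ⟨Nat.prime_two⟩
  have h := two_mul_natCard_sha_le_of_inputs_flat W K hQ2 hcm hT hneg hIQ hodd h3 hHe hsq1 hsq2 hNPh hρ Dt β ι d₁ M₀ hndiv
    hw hσ1 _ _ hR hA
  obtain ⟨t, ht⟩ := exists_natCard_primaryComponent_sha_two_eq_pow_two_mul_onHabitat_flat hQ2 W hcm hT hneg K hIQ
    hodd h3 hHe hsq1 hsq2 hNPh hρ Dt β ι d₁ M₀ hndiv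
  have h4 : 2 ^ e * 2 ^ e ≤ 4 := by interval_cases e <;> norm_num
  have hle : 2 * 2 ^ (2 * t) ≤ Nat.card (AddCommGroup.primaryComponent (↥W.sha) 2) * 4 := by
    calc 2 * 2 ^ (2 * t) ≤ Nat.card (AddCommGroup.primaryComponent (↥W.sha) 2) * 2 ^ e * 2 ^ e := by rw [← ht]; exact h
      _ = Nat.card (AddCommGroup.primaryComponent (↥W.sha) 2) * (2 ^ e * 2 ^ e) := by ring
      _ ≤ Nat.card (AddCommGroup.primaryComponent (↥W.sha) 2) * 4 := Nat.mul_le_mul_left _ h4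
  have hle' : 2 ^ (2 * t) ≤ 2 * Nat.card (AddCommGroup.primaryComponent (↥W.sha) 2) := by omega
  rw [ht]
  by_cases hY0 : Nat.card (AddCommGroup.primaryComponent (↥W.sha) 2) = 0
  · exfalso
    have hpos : 0 < 2 ^ (2 * t) := Nat.pos_of_ne_zero (pow_ne_zero _ two_ne_zero)
    omega
  · haveI : Finite (AddCommGroup.primaryComponent (↥W.sha) 2) := Nat.finite_of_card_ne_zero hY0
    obtain ⟨k, hk⟩ := exists_natCard_addPrimaryComponent_eq_pow (A := ↥W.sha) 2
    rw [hk] at hle' ⊢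
    have hkt : 2 * t ≤ k + 1 := by
      have h2 : 2 ^ (2 * t) ≤ 2 ^ (k + 1) := by rw [pow_succ]; omega
      exact (Nat.pow_le_pow_iff_right (by norm_num)).mp h2
    calc 2 ^ (2 * t) ∣ 2 ^ (k + 1) := pow_dvd_pow 2 hkt
      _ = 2 * 2 ^ k := by ring

end Summit.BirchSwinnertonDyer.BirchSwinnertonDyer.Theorems.GenusExact.PlusDescent

end
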